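import Summits.BirchSwinnertonDyer.BirchSwinnertonDyer.Theorems.Rank2Observatory2DescClFieldCertE
import Summits.BirchSwinnertonDyer.BirchSwinnertonDyer.Theorems.Rank2Observatory2DescClValuation
import HarnessLib

/-!
# BirchSwinnertonDyer — rank ≥ 2 observatory: KERNEL-2DESC-CL, SQ1 — THE PRIMES ABOVE A TOTALLY SPLIT AUXILIARY PRIME

HONEST FRAMING: per-curve certified theorems and census instruments; no claim on BSD in rank ≥ 2.

First generic file of the SPLIT-`q` variant of the KERNEL-2DESC-CL instrument (cell `b2b-bsdr2`, seat cert-1;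
design `…/kernel-2desc-cl/v2/generics/cq/PLAN-g51.md`; director-bsd RULING A = A1-tier0, 2026-08-28).  The
v2.0 record `ClFieldCert` is REUSED as a type; its auxiliary-prime slot is READ DIFFERENTLY: `q` is a rational
prime that is TOTALLY SPLIT in `K = ℚ(α)`, `g ≡ (X − r₀)(X − r₁)(X − r₂) (mod q)` with the three roots
`qr = (r₀, r₁, r₂)` pairwise incongruent and `qs` the cofactor coefficients, so that the registry row of `q` is
the split row `qEntry3 = ⟨q, 0, qr, qs, [], []⟩` of `…ClPrimeCert` (whose `primeEntry_sound` already covers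
split rows).  This is the shape met by the cyclic cubic 2-division fields of the residual census (no prime of
type `(1)(2)` exists in a Galois cubic field).  Contents:

* the Bool checkers `checkRegistry3` / `checkReg3` (registry core with the split row of `q` and the
  distinctness of the roots) — computable, run by `decide +kernel`;
* soundness: `irreducible_of_reg3`, `row_check_of_mem_reg3`, the three degree-one primes `wq i`
  (`wq_of_reg3`: prime above `q`, norm `q`), the cover `qcover_of_reg3` (every prime `∋ q` is one of them),
  pairwise distinctness `idealOf_wq_injective`, the height-one primes `WQ i` with `absNorm_WQ`, `q_mem_WQ`,
  `exists_eq_WQ`, `WQ_injective`, the exact-valuation squeeze `log_valuation_WQ_eq_of_not_mem`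
  (`x ∉ WQ j` for `j ≠ i`, `|N x| = q^e·m`, `q ∤ m` ⇒ `ord_{WQ i}(x) = e`) and `log_valuation_WQ_natCast`
  (`ord_{WQ i}(q) = 1`), and the residue characters `exists_psi_of_reg3`.

Sorry-free; new declarations only; axioms `propext`, `Classical.choice`, `Quot.sound`.
[cite: Cohen1993, §4.8.2, Thm. 4.8.13; §4.8.3] [cite: Marcus2018, Ch. 3, Thm. 22 and Thm. 27]
-/

set_option linter.dupNamespace false

noncomputable section

open scoped Classical NumberField nonZeroDivisors

open Literature.NumberTheory.NumberFields Polynomial Module NumberField IsDedekindDomain Ideal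

namespace Summit.BirchSwinnertonDyer.BirchSwinnertonDyer.Rank2Observatory.TwoDescCl

open TwoDescCubic

/-! ## Computable data and checkers -/

namespace ClFieldCert

variable (fc : ClFieldCert)

/-- The SPLIT registry row of `q`: kind `0`, roots `qr = (r₀, r₁, r₂)`, cofactors `qs`.
[cite: Cohen1993, §4.8.2] -/
def qEntry3 : PrimeEntry := ⟨fc.q, 0, fc.qr, fc.qs, [], []⟩

/-- The `i`-th root of `g` modulo `q`. -/
def qroot (i : Fin 3) : ℤ := (![fc.qr.1, fc.qr.2.1, fc.qr.2.2] : Fin 3 → ℤ) i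

/-- Code of the `i`-th prime above `q`: `(q, α − rᵢ)`. [cite: Cohen1993, §4.8.2] -/
def wq (i : Fin 3) : PCode := (fc.q, -fc.qroot i, 1, 0)

/-- The three roots are pairwise incongruent modulo `q`. Computable. -/
def qrDistinct : Bool :=
  !decide ((fc.q : ℤ) ∣ fc.qr.1 - fc.qr.2.1) && !decide ((fc.q : ℤ) ∣ fc.qr.1 - fc.qr.2.2) &&
    !decide ((fc.q : ℤ) ∣ fc.qr.2.1 - fc.qr.2.2)

/-- Registry clause, split-`q` reading: the split row of `q` is checked, its roots are distinct, and every
registry row is checked with a prime `≠ q`. Computable. [cite: Cohen1993, §4.8.2] -/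
def checkRegistry3 : Bool :=
  fc.qEntry3.check fc.a fc.b fc.c && fc.qrDistinct &&
    fc.primes.all fun e => e.check fc.a fc.b fc.c && e.p != fc.q

/-- **Registry core, split-`q` reading**: irreducibility modulo `pIrr`, the registry clause, the residue
characters — no archimedean clause, no sweep. Computable. [cite: Cohen1993, §6.5] -/
def checkReg3 : Bool := noRootMod fc.pIrr fc.a fc.b fc.c && fc.checkRegistry3 && fc.checkChars

end ClFieldCert

/-! ## Soundness -/

variable {K : Type*} [Field K] [NumberField K] {θ : K} (fc : ClFieldCert)

namespace ClFieldCert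

/-- `g` is irreducible. [folklore] -/
theorem irreducible_of_reg3 (hR : fc.checkReg3 = true) : Irreducible (MonicCubic.polyQ fc.a fc.b fc.c) := by
  simp only [checkReg3, Bool.and_eq_true] at hR
  exact irreducible_of_noRootMod hR.1.1

/-- Every registry row is checked, and its prime is not `q`. -/
theorem row_check_of_mem_reg3 (hR : fc.checkReg3 = true) {e : PrimeEntry} (he : e ∈ fc.primes) :
    e.check fc.a fc.b fc.c = true ∧ e.p ≠ fc.q := by
  simp only [checkReg3, checkRegistry3, Bool.and_eq_true, List.all_eq_true] at hR
  have h := hR.1.2.2 e he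
  exact ⟨h.1, by simpa using h.2⟩

/-- The split row of `q` is checked. -/
theorem qEntry3_check_reg3 (hR : fc.checkReg3 = true) : fc.qEntry3.check fc.a fc.b fc.c = true := by
  simp only [checkReg3, checkRegistry3, Bool.and_eq_true] at hR
  exact hR.1.2.1.1

/-- The roots are pairwise incongruent modulo `q`. -/
theorem not_dvd_sub_of_reg3 (hR : fc.checkReg3 = true) {i j : Fin 3} (hij : i ≠ j) :
    ¬ (fc.q : ℤ) ∣ fc.qroot i - fc.qroot j := by
  simp only [checkReg3, checkRegistry3, qrDistinct, Bool.and_eq_true, Bool.not_eq_eq_eq_not, Bool.not_true,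
    decide_eq_false_iff_not] at hR
  obtain ⟨⟨h01, h02⟩, h12⟩ := hR.1.2.1.2
  have hsymm : ∀ {x y : ℤ}, ¬ (fc.q : ℤ) ∣ x - y → ¬ (fc.q : ℤ) ∣ y - x := fun h hd =>
    h (by rw [← neg_sub]; exact (dvd_neg).mpr hd)
  fin_cases i <;> fin_cases j <;> simp [qroot] at hij ⊢ <;> first
    | exact h01 | exact h02 | exact h12 | exact hsymm h01 | exact hsymm h02 | exact hsymm h12

/-- The characters clause. -/
theorem checkChars_of_reg3 (hR : fc.checkReg3 = true) : fc.checkChars = true := by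
  simp only [checkReg3, Bool.and_eq_true] at hR
  exact hR.2

/-! ### The three primes above `q` -/

/-- The codes of the split row of `q`. -/
theorem qEntry3_codes : fc.qEntry3.codes = ((List.ofFn fc.qroot).map fun r => ((fc.q, -r, 1, 0) : PCode)).dedup := by
  simp [qEntry3, PrimeEntry.codes, qroot, List.ofFn_succ]

/-- `wq i` is a code of the split row. [folklore] -/
theorem wq_mem_codes (i : Fin 3) : fc.wq i ∈ fc.qEntry3.codes := by
  rw [qEntry3_codes, List.mem_dedup, List.mem_map]
  exact ⟨fc.qroot i, by rw [List.mem_ofFn]; exact ⟨i, rfl⟩, rfl⟩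

/-- Every code of the split row is a `wq i`. [folklore] -/
theorem exists_eq_wq_of_mem_codes {C : PCode} (hC : C ∈ fc.qEntry3.codes) : ∃ i, C = fc.wq i := by
  rw [qEntry3_codes, List.mem_dedup, List.mem_map] at hC
  obtain ⟨r, hr, rfl⟩ := hC
  rw [List.mem_ofFn] at hr
  obtain ⟨i, rfl⟩ := hr
  exact ⟨i, rfl⟩

/-- `codeDeg (wq i) = 1`. -/
theorem codeDeg_wq (i : Fin 3) : codeDeg (fc.wq i) = 1 := by simp [codeDeg, wq]

/-- **`W_i = (q, α − rᵢ)` is a prime above `q` of norm `q`.** [cite: Cohen1993, §4.8.2, Thm. 4.8.13] -/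
theorem wq_of_reg3 (hθ : aeval θ (MonicCubic.poly fc.a fc.b fc.c) = 0) (h3 : finrank ℚ K = 3)
    (hR : fc.checkReg3 = true) (hpr : fc.primeList.Forall Nat.Prime) (i : Fin 3) :
    idealOf hθ (fc.wq i) ∈ primesOver (span {(fc.q : ℤ)}) (𝓞 K) ∧ absNorm (idealOf hθ (fc.wq i)) = fc.q := by
  have h := (primeEntry_sound (fc.irreducible_of_reg3 hR) hθ h3 fc.qEntry3 (fc.q_prime hpr)
    (fc.qEntry3_check_reg3 hR)).1 (fc.wq i) (fc.wq_mem_codes i)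
  rw [codeDeg_wq, pow_one] at h
  exact h

/-- **Every prime containing `q` is one of the three.** [cite: Cohen1993, §4.8.2, Thm. 4.8.13] -/
theorem qcover_of_reg3 (hθ : aeval θ (MonicCubic.poly fc.a fc.b fc.c) = 0) (h3 : finrank ℚ K = 3)
    (hR : fc.checkReg3 = true) (hpr : fc.primeList.Forall Nat.Prime) (P : Ideal (𝓞 K)) (hP : P.IsPrime)
    (hq : (fc.q : 𝓞 K) ∈ P) : ∃ i, P = idealOf hθ (fc.wq i) := by
  obtain ⟨C, hC, rfl⟩ := (primeEntry_sound (fc.irreducible_of_reg3 hR) hθ h3 fc.qEntry3 (fc.q_prime hpr)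
    (fc.qEntry3_check_reg3 hR)).2 P hP hq
  obtain ⟨i, rfl⟩ := fc.exists_eq_wq_of_mem_codes hC
  exact ⟨i, rfl⟩

omit [NumberField K] in
/-- `α − rᵢ ∈ W_i`. [folklore] -/
theorem lin_root_mem_idealOf_wq (hθ : aeval θ (MonicCubic.poly fc.a fc.b fc.c) = 0) (i : Fin 3) :
    lin hθ (-fc.qroot i) 1 0 ∈ idealOf hθ (fc.wq i) :=
  Ideal.subset_span (by simp [wq])

omit [NumberField K] in
/-- `q ∈ W_i`. [folklore] -/
theorem natCast_mem_idealOf_wq (hθ : aeval θ (MonicCubic.poly fc.a fc.b fc.c) = 0) (i : Fin 3) :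
    ((fc.q : ℕ) : 𝓞 K) ∈ idealOf hθ (fc.wq i) :=
  Ideal.subset_span (by simp [wq])

/-- **The three primes are pairwise distinct** (the roots are incongruent modulo `q`). [folklore] -/
theorem idealOf_wq_injective (hθ : aeval θ (MonicCubic.poly fc.a fc.b fc.c) = 0) (h3 : finrank ℚ K = 3)
    (hR : fc.checkReg3 = true) (hpr : fc.primeList.Forall Nat.Prime) {i j : Fin 3}
    (h : idealOf hθ (fc.wq i) = idealOf hθ (fc.wq j)) : i = j := by
  by_contra hij
  have hP := (fc.wq_of_reg3 hθ h3 hR hpr i).1.1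
  -- the integer `rⱼ − rᵢ` lies in `W_i`
  have hd : ((fc.qroot j - fc.qroot i : ℤ) : 𝓞 K) ∈ idealOf hθ (fc.wq i) := by
    have h₁ := fc.lin_root_mem_idealOf_wq hθ i
    have h₂ := fc.lin_root_mem_idealOf_wq hθ j
    rw [← h] at h₂
    have := Ideal.sub_mem _ h₁ h₂
    simp only [lin] at this
    push_cast at this ⊢
    convert this using 1
    ring
  -- Bézout: `q` and `rⱼ − rᵢ` are coprime, so `1 ∈ W_i`
  have hcop : IsCoprime (fc.q : ℤ) (fc.qroot j - fc.qroot i) := by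
    rw [Int.isCoprime_iff_gcd_eq_one]
    have hq := fc.q_prime hpr
    have hnd := fc.not_dvd_sub_of_reg3 hR (Ne.symm hij)
    rw [Int.gcd_comm]
    have : Int.gcd (fc.qroot j - fc.qroot i) fc.q ∣ fc.q := Int.gcd_dvd_natAbs_right _ _
    rcases (Nat.dvd_prime hq).mp this with h1 | hq'
    · exact h1
    · exfalso
      apply hnd
      have hdvd : ((Int.gcd (fc.qroot j - fc.qroot i) fc.q : ℕ) : ℤ) ∣ fc.qroot j - fc.qroot i := Int.gcd_dvd_left ..
      rwa [hq'] at hdvd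
  obtain ⟨u, v, huv⟩ := hcop
  have h1 : (1 : 𝓞 K) ∈ idealOf hθ (fc.wq i) := by
    have hq := fc.natCast_mem_idealOf_wq hθ i
    have := Ideal.add_mem _ (Ideal.mul_mem_left _ ((u : ℤ) : 𝓞 K) hq) (Ideal.mul_mem_left _ ((v : ℤ) : 𝓞 K) hd)
    convert this using 1
    exact_mod_cast congrArg (fun z : ℤ => ((z : ℤ) : 𝓞 K)) huv.symm
  exact hP.ne_top ((Ideal.eq_top_iff_one _).mpr h1)

/-! ### The height-one primes `WQ i` -/

/-- **`WQ i`**, the `i`-th prime above the totally split `q`, as a height-one prime. -/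
def WQ (hθ : aeval θ (MonicCubic.poly fc.a fc.b fc.c) = 0) (h3 : finrank ℚ K = 3) (hR : fc.checkReg3 = true)
    (hpr : fc.primeList.Forall Nat.Prime) (i : Fin 3) : HeightOneSpectrum (𝓞 K) :=
  primeOfCode (fc.irreducible_of_reg3 hR) hθ h3 (e := fc.qEntry3) (fc.q_prime hpr) (fc.qEntry3_check_reg3 hR)
    (fc.wq_mem_codes i)

variable {fc}

section WQ
variable (hθ : aeval θ (MonicCubic.poly fc.a fc.b fc.c) = 0) (h3 : finrank ℚ K = 3) (hR : fc.checkReg3 = true)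
  (hpr : fc.primeList.Forall Nat.Prime)

/-- `WQ i` is presented by its code. [folklore] -/
theorem WQ_asIdeal (i : Fin 3) : (fc.WQ hθ h3 hR hpr i).asIdeal = idealOf hθ (fc.wq i) := rfl

/-- `N(WQ i) = q`. [cite: Cohen1993, §4.8.2, Thm. 4.8.13] -/
theorem absNorm_WQ (i : Fin 3) : absNorm (fc.WQ hθ h3 hR hpr i).asIdeal = fc.q := (fc.wq_of_reg3 hθ h3 hR hpr i).2

/-- `q ∈ WQ i`. [folklore] -/
theorem q_mem_WQ (i : Fin 3) : ((fc.q : ℕ) : 𝓞 K) ∈ (fc.WQ hθ h3 hR hpr i).asIdeal :=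
  fc.natCast_mem_idealOf_wq hθ i

/-- **Cover**: every height-one prime containing `q` is a `WQ i`. [cite: Cohen1993, §4.8.2, Thm. 4.8.13] -/
theorem exists_eq_WQ (u : HeightOneSpectrum (𝓞 K)) (hu : ((fc.q : ℕ) : 𝓞 K) ∈ u.asIdeal) :
    ∃ i, u = fc.WQ hθ h3 hR hpr i := by
  obtain ⟨i, hi⟩ := fc.qcover_of_reg3 hθ h3 hR hpr u.asIdeal u.isPrime hu
  exact ⟨i, HeightOneSpectrum.ext hi⟩

/-- **Distinctness**: `WQ` is injective. [folklore] -/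
theorem WQ_injective : Function.Injective (fc.WQ hθ h3 hR hpr) := fun _ _ h =>
  fc.idealOf_wq_injective hθ h3 hR hpr (congrArg HeightOneSpectrum.asIdeal h)

/-- `WQ i ≠ WQ j` for `i ≠ j`. [folklore] -/
theorem WQ_ne {i j : Fin 3} (hij : i ≠ j) : fc.WQ hθ h3 hR hpr i ≠ fc.WQ hθ h3 hR hpr j := fun h =>
  hij (WQ_injective hθ h3 hR hpr h)

/-- The set `U_q = {WQ 0, WQ 1, WQ 2}` of the primes above `q`. -/
def UQ : Finset (HeightOneSpectrum (𝓞 K)) := Finset.univ.image (fc.WQ hθ h3 hR hpr)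

/-- `U_q` contains every prime containing `q`. [folklore] -/
theorem mem_UQ_of_q_mem (u : HeightOneSpectrum (𝓞 K)) (hu : ((fc.q : ℕ) : 𝓞 K) ∈ u.asIdeal) :
    u ∈ UQ hθ h3 hR hpr := by
  obtain ⟨i, rfl⟩ := exists_eq_WQ hθ h3 hR hpr u hu
  exact Finset.mem_image.mpr ⟨i, Finset.mem_univ _, rfl⟩

/-- `WQ i ∈ U_q`. [folklore] -/
theorem WQ_mem_UQ (i : Fin 3) : fc.WQ hθ h3 hR hpr i ∈ UQ hθ h3 hR hpr :=
  Finset.mem_image.mpr ⟨i, Finset.mem_univ _, rfl⟩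

/-- Members of `U_q` are `WQ i`. [folklore] -/
theorem exists_eq_WQ_of_mem_UQ {u : HeightOneSpectrum (𝓞 K)} (hu : u ∈ UQ hθ h3 hR hpr) :
    ∃ i, u = fc.WQ hθ h3 hR hpr i := by
  obtain ⟨i, -, rfl⟩ := Finset.mem_image.mp hu
  exact ⟨i, rfl⟩

/-- Norms on `U_q` (residue degree `1` throughout). [folklore] -/
theorem absNorm_of_mem_UQ (u : HeightOneSpectrum (𝓞 K)) (hu : u ∈ UQ hθ h3 hR hpr) :
    absNorm u.asIdeal = fc.q ^ (fun _ : HeightOneSpectrum (𝓞 K) => 1) u := by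
  obtain ⟨i, rfl⟩ := exists_eq_WQ_of_mem_UQ hθ h3 hR hpr hu
  simpa using absNorm_WQ hθ h3 hR hpr i

/-- **EXACT VALUATION by the single-prime squeeze at `WQ i`**: if `x ∉ WQ j` for both `j ≠ i` and
`|N(x)| = q^e · m` with `q ∤ m`, then `ord_{WQ i}(x) = e`. [cite: Cohen1993, §4.8.3] [cite: Marcus2018, Ch. 3, Thm. 22] -/
theorem log_valuation_WQ_eq_of_not_mem (i : Fin 3) {x : 𝓞 K}
    (hothers : ∀ j, j ≠ i → x ∉ (fc.WQ hθ h3 hR hpr j).asIdeal) {e m : ℕ}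
    (hN : (Algebra.norm ℤ x).natAbs = fc.q ^ e * m) (hm : ¬ fc.q ∣ m) :
    WithZero.log ((fc.WQ hθ h3 hR hpr i).valuation K (x : K)) = -(e : ℤ) := by
  refine log_valuation_eq_of_forall_not_mem (fc.q_prime hpr) (UQ hθ h3 hR hpr) (mem_UQ_of_q_mem hθ h3 hR hpr)
    (fun _ => 1) (absNorm_of_mem_UQ hθ h3 hR hpr) (WQ_mem_UQ hθ h3 hR hpr i) Nat.one_pos ?_ (by simpa using hN) hm
  intro u hu hne
  obtain ⟨j, rfl⟩ := exists_eq_WQ_of_mem_UQ hθ h3 hR hpr hu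
  exact hothers j (fun h => hne (by rw [h]))

include hθ h3 hR in
/-- `|N(q)| = q³ · 1`. [cite: Marcus2018, Ch. 2, Thm. 4] -/
theorem natAbs_norm_natCast_q : (Algebra.norm ℤ ((fc.q : ℕ) : 𝓞 K)).natAbs = fc.q ^ 3 * 1 := by
  have e := natAbs_norm_lin_coords (fc.irreducible_of_reg3 hR) hθ h3 ((fc.q : ℤ), 0, 0)
  simp only at e
  have hl : (lin hθ (fc.q : ℤ) 0 0 : 𝓞 K) = ((fc.q : ℕ) : 𝓞 K) := by simp [lin]
  rw [hl] at e
  rw [e]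
  simp [normFormZ, Int.natAbs_pow]

/-- **`ord_{WQ i}(q) = 1`** for each of the three primes (`q` is unramified: `∑ᵢ ord_{WQ i}(q) = 3` with every
term `≥ 1`). [cite: Marcus2018, Ch. 3, Thm. 22] -/
theorem log_valuation_WQ_natCast (i : Fin 3) :
    WithZero.log ((fc.WQ hθ h3 hR hpr i).valuation K ((((fc.q : ℕ) : 𝓞 K) : 𝓞 K) : K)) = -1 := by
  have hq := fc.q_prime hpr
  have hx : ((fc.q : ℕ) : 𝓞 K) ≠ 0 := by exact_mod_cast hq.ne_zero
  have h := sum_mul_log_valuation_eq hq (UQ hθ h3 hR hpr) (mem_UQ_of_q_mem hθ h3 hR hpr) (fun _ => 1)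
    (absNorm_of_mem_UQ hθ h3 hR hpr) hx
  rw [natAbs_norm_natCast_q hθ h3 hR, factorization_pow_mul_eq hq
    (fun hd => hq.one_lt.ne' (Nat.dvd_one.mp hd))] at h
  -- rewrite the sum over `U_q` as a sum over `Fin 3`
  rw [UQ, Finset.sum_image (fun a _ b _ hab => WQ_injective hθ h3 hR hpr hab)] at h
  simp only [Nat.cast_one, one_mul, Nat.cast_ofNat] at h
  -- every term is `≤ -1`
  have hle : ∀ j : Fin 3, WithZero.log ((fc.WQ hθ h3 hR hpr j).valuation K ((((fc.q : ℕ) : 𝓞 K) : 𝓞 K) : K)) ≤ -1 := by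
    intro j
    have hv : (fc.WQ hθ h3 hR hpr j).valuation K ((((fc.q : ℕ) : 𝓞 K) : 𝓞 K) : K) < 1 := by
      rw [RingOfIntegers.coe_eq_algebraMap]
      exact (HeightOneSpectrum.valuation_lt_one_iff_mem (v := fc.WQ hθ h3 hR hpr j) (K := K) _).mpr (q_mem_WQ hθ h3 hR hpr j)
    have hv0 : (fc.WQ hθ h3 hR hpr j).valuation K ((((fc.q : ℕ) : 𝓞 K) : 𝓞 K) : K) ≠ 0 :=
      (Valuation.ne_zero_iff _).mpr (RingOfIntegers.coe_ne_zero_iff.mpr hx)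
    have := (WithZero.log_lt_iff_lt_exp hv0).mpr (by rwa [WithZero.exp_zero])
    omega
  by_contra hne
  have hlt : WithZero.log ((fc.WQ hθ h3 hR hpr i).valuation K ((((fc.q : ℕ) : 𝓞 K) : 𝓞 K) : K)) < -1 :=
    lt_of_le_of_ne (hle i) hne
  have hsum := Finset.sum_lt_sum (s := (Finset.univ : Finset (Fin 3))) (fun j _ => hle j)
    ⟨i, Finset.mem_univ _, hlt⟩
  rw [h, Fin.sum_univ_three] at hsum
  omega

end WQ

/-! ### Residue characters -/

/-- **The residue map `ψ_{ℓ,t} : 𝓞 K → ℤ/ℓ`, `α ↦ t`**, for every character row, with `ℓ` an odd prime.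
[cite: Marcus2018, Ch. 3, Thm. 27] -/
theorem exists_psi_of_reg3 (hθ : aeval θ (MonicCubic.poly fc.a fc.b fc.c) = 0) (h3 : finrank ℚ K = 3)
    (hR : fc.checkReg3 = true) (hpr : fc.primeList.Forall Nat.Prime) {ch : ℕ × ℤ × ℤ} (hch : ch ∈ fc.chars) :
    2 < ch.1 ∧ ∃ ψ : 𝓞 K →+* ZMod ch.1, ψ (MonicCubic.thetaInt hθ) = ((ch.2.1 : ℤ) : ZMod ch.1) := by
  have hirr := fc.irreducible_of_reg3 hR
  simp only [checkReg3, checkChars, Bool.and_eq_true, decide_eq_true_eq, List.all_eq_true] at hR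
  obtain ⟨⟨h2, hroot⟩, hinv⟩ := hR.2 ch hch
  obtain ⟨ℓ, t, dinv⟩ := ch
  simp only at h2 hroot hinv ⊢
  have hℓ : ℓ.Prime := fc.char_prime hpr hch
  haveI : NeZero ℓ := ⟨hℓ.ne_zero⟩
  refine ⟨h2, MonicCubic.exists_ringHom_of_root_of_mul_mem hirr hθ h3 (natAbs_disc_mul_mem_adjoin hirr hθ h3)
    ((t : ℤ) : ZMod ℓ) ?_ ((dinv : ℤ) : ZMod ℓ) ?_⟩
  · have h0 := (ZMod.intCast_zmod_eq_zero_iff_dvd _ ℓ).mpr (Int.dvd_of_emod_eq_zero hroot)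
    push_cast at h0
    exact h0
  · have h1 : ((((MonicCubic.disc fc.a fc.b fc.c).natAbs : ℤ) * dinv : ℤ) : ZMod ℓ) = ((1 : ℤ) : ZMod ℓ) := by
      rw [ZMod.intCast_eq_intCast_iff', hinv, Int.emod_eq_of_lt (by norm_num) (by have := hℓ.one_lt; omega)]
    simp only [Int.cast_mul, Int.cast_natCast, Int.cast_one] at h1
    exact h1

end ClFieldCert

/-! ## Kernel sanity check: the cyclic cubic field of conductor `61` -/

/-- The cyclic cubic field of conductor `61` hosting seven tier-0 residual curves: `g = X³ − X² − 20X + 9`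
(`polredabs`, index `3`), `q = 11` totally split with roots `1, 3, 8`, `g − (X−1)(X−3)(X−8) = 11·(3 − 5X + X²)`;
no sweep, no characters, junk unit/`γ` slots (unused by the split-`q` reading). [folklore] -/
def f61 : ClFieldCert :=
  ⟨-1, -20, 9, 2, 0, 1, 0, 11, (1, 3, 8), (3, -5, 1), [],
    ⟨(0, 0, 0), (0, 0, 0), false, (0, 0, 0), 0, 0, (0, 0, 0), []⟩,
    ⟨(0, 0, 0), (0, 0, 0), false, (0, 0, 0), 0, 0, (0, 0, 0), []⟩, []⟩

/-- The record passes the split-`q` registry core. -/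
example : f61.checkReg3 = true := by decide +kernel

/-- NEGATIVE control: the `(1)(2)` registry core of v2.0 REJECTS the same record (its row of `q` is not of
type `(1)(2)`). -/
example : f61.checkReg = false := by decide +kernel

end Summit.BirchSwinnertonDyer.BirchSwinnertonDyer.Rank2Observatory.TwoDescCl

end
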